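import Summits.BirchSwinnertonDyer.BirchSwinnertonDyer.Theorems.Rank2ObservatoryTamagawaLocal
import Summits.BirchSwinnertonDyer.BirchSwinnertonDyer.Theorems.Rank2ObservatoryRank3MinimalTotal
import HarnessLib

/-!
# BSD rank ≥ 2 observatory (`b2b-bsdr2`, cert-2 gen 10): KERNEL CERTIFICATES of the local Tamagawa
# numbers — part 3/3: ROW certificates, the Tamagawa product, and the census walker

HONEST FRAMING: per-curve certified theorems and census instruments; no claim on BSD in rank ≥ 2.

Theorems and kernel-decidable certificate formats only (no named fact, no axiom).  A ROW certificate
of an integer equation `W₀` is a list `Es` of local certificates (`TamLocal`, part 2) with distinct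
primes whose prime powers `∏ pⁿ` multiply to `|Δ(W₀)|` (so EVERY bad prime is listed, as in the cell's
root-number certificates).  `TamLocal.rowCheck Es W₀` then gives, for `W₀ ⊗ ℚ` globally minimal:

* `tam_eq_one_of_not_mem`: `c_v = 1` at every place `v` over an unlisted prime;
* `tam_mem_vals_of_mem`: `c_v ∈ E.vals` at the place over a listed prime (`TamLocal.sound`);
* `tamagawaProduct_mem`: the tree's TAMAGAWA PRODUCT
  `(W₀ ⊗ ℚ).tamagawaProduct = ∏ᶠ_v c_v` (`Literature/NumberTheory/EllipticCurves/Tamagawa`) lies in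
  the finite set `rowVals Es` of products of the certified local value sets — via the finitely
  supported product over the places of `𝓞 ℚ` written as a list product (`finprod_eq_prod_map_pl`,
  places named by primes through Mathlib's `primesEquiv`);
* `tamagawaProduct_eq`: `= rowValue Es = ∏ c` (the engines' values) when every local set is a
  singleton (`rowExact`: all bad places multiplicative or of type `II`, `III`, `III*`, `II*`).

For the rank-3 census `rank3Table` (9 487 rows, proved globally minimal in the tree,
`Rank3Row.isGloballyMinimal_of_mem`) the compact row data `TamC` and the position-indexed one-pass
walker `tamWalk` (pattern of the cell's `condWalk`) turn a machine-written chunk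
`List (ℕ × List TamC)` into the theorem `tamagawa_of_tamWalk`: for every listed `(i, R)`, row `i`'s
Tamagawa product lies in `rowVals`, equals `rowValue` on exact rows, with the local statements at every
place — NO hypothesis beyond the kernel check `tamWalk rank3Table 0 chunk = true`.

References: J. H. Silverman, *Advanced Topics in the Arithmetic of Elliptic Curves*, GTM 151 (1994),
IV.9.4 [SilvermanATAEC1994] [Silverman1994]; J. H. Silverman, *The Arithmetic of Elliptic Curves*,
2nd ed. (2009), VII.5 Prop. 5.1, VIII.8 [SilvermanAEC2009]; J. E. Cremona, *Algorithms for Modular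
Elliptic Curves*, 2nd ed. (1997), §3.2 and Table 1 (column `c_p`) [CremonaAlgorithms1997].
-/

set_option linter.dupNamespace false
set_option autoImplicit false

open scoped NumberField
open IsDedekindDomain Rat.HeightOneSpectrum WeierstrassCurve Literature.NumberTheory.DiophantineGeometry

namespace Summit.BirchSwinnertonDyer.BirchSwinnertonDyer.Rank2Observatory.Tam

/-! ### Places of `𝓞 ℚ` named by natural numbers -/

/-- The finite place of `𝓞 ℚ` over the natural number `p`: `primesEquiv.symm p` for a prime `p` (the
place of `2` as a junk value otherwise) — a TOTAL function of `p : ℕ`, so that certificates can list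
bad primes as numerals (port of the cell's `RootNumber.natPlace` to `𝓞 ℚ`). [folklore] -/
noncomputable def pl (p : ℕ) : HeightOneSpectrum (𝓞 ℚ) :=
  if hp : p.Prime then (primesEquiv (R := 𝓞 ℚ)).symm ⟨p, hp⟩
  else (primesEquiv (R := 𝓞 ℚ)).symm ⟨2, Nat.prime_two⟩

/-- The prime under `pl p` is `p`. [folklore] -/
theorem natGenerator_pl {p : ℕ} (hp : p.Prime) : natGenerator (pl p) = p := by
  rw [pl, dif_pos hp]
  exact congrArg Subtype.val ((primesEquiv (R := 𝓞 ℚ)).apply_symm_apply ⟨p, hp⟩)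

/-- `pl` is a left inverse of `natGenerator`. [folklore] -/
theorem pl_natGenerator (v : HeightOneSpectrum (𝓞 ℚ)) : pl (natGenerator v) = v := by
  rw [pl, dif_pos (prime_natGenerator v), Equiv.symm_apply_eq]
  rfl

/-- **A finitely supported product over the places of `𝓞 ℚ` as a list product**: if `f v = 1` unless
the prime under `v` lies in the duplicate-free list of primes `L`, then `∏ᶠ_v f v = ∏_{p ∈ L} f (pl p)`.
[folklore] -/
theorem finprod_eq_prod_map_pl {M : Type*} [CommMonoid M] (f : HeightOneSpectrum (𝓞 ℚ) → M)
    (L : List ℕ) (hL : L.Nodup) (hprime : ∀ p ∈ L, p.Prime) (hf : ∀ v, natGenerator v ∉ L → f v = 1) :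
    ∏ᶠ v, f v = (L.map fun p => f (pl p)).prod := by
  classical
  have hinj : ∀ p ∈ L, ∀ q ∈ L, pl p = pl q → p = q := fun p hp q hq h ↦ by
    rw [← natGenerator_pl (hprime p hp), h, natGenerator_pl (hprime q hq)]
  have hnd : (L.map pl).Nodup := hL.map_on hinj
  have hsupp : Function.mulSupport f ⊆ ((L.map pl).toFinset : Set (HeightOneSpectrum (𝓞 ℚ))) := by
    intro v hv
    rw [Function.mem_mulSupport] at hv
    rw [Finset.mem_coe, List.mem_toFinset, List.mem_map]
    by_contra h
    exact hv (hf v fun hmem ↦ h ⟨natGenerator v, hmem, pl_natGenerator v⟩)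
  rw [finprod_eq_prod_of_mulSupport_subset f hsupp, List.prod_toFinset _ hnd, List.map_map]
  rfl

/-! ### Products of value sets -/

/-- All products `a₁ ⋯ a_k` with `aᵢ` in the `i`-th list (`[1]` for the empty list). [folklore] -/
def valsProd : List (List ℕ) → List ℕ
  | [] => [1]
  | l :: ls => l.flatMap fun a => (valsProd ls).map (a * ·)

/-- A product of members lies in `valsProd`. [folklore] -/
theorem prod_mem_valsProd :
    ∀ {xs : List ℕ} {ls : List (List ℕ)}, List.Forall₂ (· ∈ ·) xs ls → xs.prod ∈ valsProd ls
  | _, _, .nil => by simp [valsProd]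
  | x :: _, l :: _, .cons h hs => by
    simp only [valsProd, List.prod_cons, List.mem_flatMap, List.mem_map]
    exact ⟨x, h, _, prod_mem_valsProd hs, rfl⟩

/-- `valsProd` of singletons is the singleton of the product. [folklore] -/
theorem valsProd_map_singleton : ∀ cs : List ℕ, valsProd (cs.map fun c => [c]) = [cs.prod]
  | [] => rfl
  | c :: cs => by simp [valsProd, valsProd_map_singleton cs]

/-! ### Row certificates -/

namespace TamLocal

/-- The kernel check of a ROW certificate on the integer equation `W`: every local certificate checks,
the primes are distinct, and `|Δ(W)| = ∏ pⁿ` (completeness of the list of bad primes). [folklore] -/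
def rowCheck (Es : List TamLocal) (W : WeierstrassCurve ℤ) : Bool :=
  Es.all (fun E => E.check W) && decide ((Es.map (·.p)).Nodup) &&
    decide (W.Δ.natAbs = (Es.map fun E => E.p ^ E.n).prod)

/-- The certified finite set of values of the Tamagawa product. [folklore] -/
def rowVals (Es : List TamLocal) : List ℕ := valsProd (Es.map (·.vals))

/-- The engines' Tamagawa product `∏ c`. [folklore] -/
def rowValue (Es : List TamLocal) : ℕ := (Es.map (·.c)).prod

/-- Every local value set is a singleton ("kernel-exact" row). [folklore] -/
def rowExact (Es : List TamLocal) : Bool := Es.all fun E => decide (E.vals.length = 1)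

variable {Es : List TamLocal} {W₀ : WeierstrassCurve ℤ}

/-- Unpacking a passing row check. [folklore] -/
theorem rowCheck_spec (h : rowCheck Es W₀ = true) :
    (∀ E ∈ Es, E.check W₀ = true) ∧ (Es.map (·.p)).Nodup ∧
      W₀.Δ.natAbs = (Es.map fun E => E.p ^ E.n).prod := by
  simp only [rowCheck, Bool.and_eq_true, List.all_eq_true, decide_eq_true_eq] at h
  exact ⟨h.1.1, h.1.2, h.2⟩

/-- Listed primes are prime. [folklore] -/
theorem prime_of_mem_map (h : rowCheck Es W₀ = true) {p : ℕ} (hp : p ∈ Es.map (·.p)) : p.Prime := by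
  obtain ⟨E, hE, rfl⟩ := List.mem_map.mp hp
  exact (check_common ((rowCheck_spec h).1 E hE)).1

/-- A passing row check forces `Δ ≠ 0`. [folklore] -/
theorem Δ_ne_zero_of_rowCheck (h : rowCheck Es W₀ = true) : W₀.Δ ≠ 0 := by
  intro h0
  have hfac := (rowCheck_spec h).2.2
  rw [h0, Int.natAbs_zero] at hfac
  obtain ⟨E, hE, hx⟩ := List.mem_map.mp (List.prod_eq_zero_iff.mp hfac.symm)
  exact pow_ne_zero _ (check_common ((rowCheck_spec h).1 E hE)).1.ne_zero hx

/-- … so `W₀ ⊗ ℚ` is an elliptic curve. [folklore] -/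
theorem isElliptic_of_rowCheck (h : rowCheck Es W₀ = true) : (W₀.baseChange ℚ).IsElliptic :=
  WeierstrassCurve.isElliptic_baseChange_int _ (Δ_ne_zero_of_rowCheck h)

/-- **Completeness**: every prime factor of `Δ(W₀)` is listed. [folklore] -/
theorem mem_of_prime_dvd (h : rowCheck Es W₀ = true) {q : ℕ} (hq : q.Prime) (hqd : (q : ℤ) ∣ W₀.Δ) :
    q ∈ Es.map (·.p) := by
  obtain ⟨hall, -, hfac⟩ := rowCheck_spec h
  have h1 : q ∣ W₀.Δ.natAbs := Int.natCast_dvd.mp hqd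
  rw [hfac] at h1
  obtain ⟨a, ha, hqa⟩ := (Prime.dvd_prod_iff hq.prime).mp h1
  obtain ⟨E, hE, rfl⟩ := List.mem_map.mp ha
  exact List.mem_map.mpr ⟨E, hE, ((Nat.prime_dvd_prime_iff_eq hq (check_common (hall E hE)).1).mp
    (hq.dvd_of_dvd_pow hqa)).symm⟩

/-- **Local census at an unlisted place**: `c_v = 1`. [cite: SilvermanAEC2009, VII.5 Prop. 5.1(a)] -/
theorem tam_eq_one_of_not_mem (h : rowCheck Es W₀ = true) (v : HeightOneSpectrum (𝓞 ℚ))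
    (hv : natGenerator v ∉ Es.map (·.p)) : tam W₀ v = 1 := by
  haveI := isElliptic_of_rowCheck h
  exact tam_eq_one_of_not_dvd rfl fun hd ↦ hv (mem_of_prime_dvd h (prime_natGenerator v) hd)

/-- **Local census at a listed place**: `c_v ∈ E.vals` (for `W₀ ⊗ ℚ` globally minimal).
[cite: SilvermanATAEC1994, IV.9.4] -/
theorem tam_mem_vals_of_mem (h : rowCheck Es W₀ = true) (hGM : (W₀.baseChange ℚ).IsGloballyMinimal)
    {E : TamLocal} (hE : E ∈ Es) (v : HeightOneSpectrum (𝓞 ℚ)) (hv : natGenerator v = E.p) :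
    tam W₀ v ∈ E.vals :=
  sound v hv (hGM.isMinimal v) ((rowCheck_spec h).1 E hE)

/-- **The Tamagawa product lies in the certified set** `rowVals Es` (for `W₀ ⊗ ℚ` globally minimal):
`∏ᶠ_v c_v` is the list product over the listed primes (`c_v = 1` elsewhere), each factor in its
certified set. [cite: SilvermanATAEC1994, IV.9.4] -/
theorem tamagawaProduct_mem (h : rowCheck Es W₀ = true) (hGM : (W₀.baseChange ℚ).IsGloballyMinimal) :
    (W₀.baseChange ℚ).tamagawaProduct ∈ rowVals Es := by
  obtain ⟨-, hnd, -⟩ := rowCheck_spec h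
  have key : (W₀.baseChange ℚ).tamagawaProduct = (Es.map fun E => tam W₀ (pl E.p)).prod := by
    change ∏ᶠ v, tam W₀ v = _
    rw [finprod_eq_prod_map_pl (tam W₀) (Es.map (·.p)) hnd (fun p hp ↦ prime_of_mem_map h hp)
      (tam_eq_one_of_not_mem h), List.map_map]
    rfl
  rw [key, rowVals]
  refine prod_mem_valsProd ?_
  rw [List.forall₂_map_left_iff, List.forall₂_map_right_iff, List.forall₂_same]
  exact fun E hE ↦ tam_mem_vals_of_mem h hGM hE _
    (natGenerator_pl (prime_of_mem_map h (List.mem_map.mpr ⟨E, hE, rfl⟩)))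

/-- **Exact rows**: if every local set is a singleton, the Tamagawa product IS the engines' product
`rowValue Es`. [cite: SilvermanATAEC1994, IV.9.4] -/
theorem tamagawaProduct_eq (h : rowCheck Es W₀ = true) (hGM : (W₀.baseChange ℚ).IsGloballyMinimal)
    (hx : rowExact Es = true) : (W₀.baseChange ℚ).tamagawaProduct = rowValue Es := by
  have hm := tamagawaProduct_mem h hGM
  have hvals : Es.map (·.vals) = (Es.map (·.c)).map fun c => [c] := by
    rw [List.map_map]
    refine List.map_congr_left fun E hE ↦ ?_
    have h1 : E.vals.length = 1 := by
      simpa using List.all_eq_true.mp hx E hE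
    have hc := c_mem_vals ((rowCheck_spec h).1 E hE)
    obtain ⟨a, ha⟩ := List.length_eq_one_iff.mp h1
    rw [ha, List.mem_singleton] at hc
    simp [ha, hc]
  rwa [rowVals, hvals, valsProd_map_singleton, List.mem_singleton] at hm

end TamLocal

/-! ### Compact row data and the census walker -/

/-- COMPACT row data for the machine-written chunks: `m p sq kind w n c` a multiplicative local
certificate (kinds `1`–`3`: `r = s = t = exit = k = 0`), `a p sq kind r s t n exit k c` an additive one
(kinds `4`, `5`: `w = 0`). [folklore] -/
inductive TamC where
  /-- multiplicative: `⟨p, sq, kind, w, 0, 0, 0, n, 0, 0, c⟩` -/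
  | m (p sq kind : ℕ) (w : ℤ) (n c : ℕ)
  /-- additive: `⟨p, sq, kind, 0, r, s, t, n, exit, k, c⟩` -/
  | a (p sq kind : ℕ) (r s t : ℤ) (n exit k c : ℕ)
  deriving Repr, DecidableEq, Inhabited

/-- Decompression to a `TamLocal`. [folklore] -/
def TamC.toLocal : TamC → TamLocal
  | .m p sq kind w n c => ⟨p, sq, kind, w, 0, 0, 0, n, 0, 0, c⟩
  | .a p sq kind r s t n exit k c => ⟨p, sq, kind, 0, r, s, t, n, exit, k, c⟩

/-- One-pass position-indexed walk over a table of census rows: the pairs `(i, R)` (indices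
increasing) are row-checked against the `i`-th row's integer model. [folklore] -/
def tamWalk : List Rank3Row → ℕ → List (ℕ × List TamC) → Bool
  | _, _, [] => true
  | [], _, _ :: _ => false
  | r :: rs, n, (i, R) :: rest =>
      if i = n then TamLocal.rowCheck (R.map TamC.toLocal) r.intModel && tamWalk rs (n + 1) rest
      else tamWalk rs (n + 1) ((i, R) :: rest)

/-- What a passing walk says about each listed pair. [folklore] -/
theorem entry_of_tamWalk :
    ∀ (rows : List Rank3Row) (n : ℕ) (ps : List (ℕ × List TamC)), tamWalk rows n ps = true →
      ∀ (i : ℕ) (R : List TamC), (i, R) ∈ ps → n ≤ i ∧ ∃ r : Rank3Row, rows[i - n]? = some r ∧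
        TamLocal.rowCheck (R.map TamC.toLocal) r.intModel = true
  | _, _, [], _, i, R, hm => by simp at hm
  | [], _, _ :: _, h, _, _, _ => by simp [tamWalk] at h
  | r :: rs, n, (j, d) :: rest, h, i, R, hm => by
    by_cases hj : j = n
    · simp only [tamWalk, hj, ↓reduceIte, Bool.and_eq_true] at h
      rcases List.mem_cons.mp hm with he | hm'
      · obtain ⟨hin, hcd⟩ := Prod.mk.inj he
        rw [hj] at hin
        exact ⟨by omega, r, by rw [hin, Nat.sub_self]; rfl, by rw [hcd]; exact h.1⟩
      · obtain ⟨hle, r', hr', he'⟩ := entry_of_tamWalk rs (n + 1) rest h.2 i R hm'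
        refine ⟨by omega, r', ?_, he'⟩
        rw [show i - n = (i - (n + 1)) + 1 by omega, List.getElem?_cons_succ]
        exact hr'
    · simp only [tamWalk, hj, ↓reduceIte] at h
      obtain ⟨hle, r', hr', he'⟩ := entry_of_tamWalk rs (n + 1) ((j, d) :: rest) h i R hm
      refine ⟨by omega, r', ?_, he'⟩
      rw [show i - n = (i - (n + 1)) + 1 by omega, List.getElem?_cons_succ]
      exact hr'

/-- **The Tamagawa census theorem behind every chunk** — NO named fact, NO hypothesis beyond the
kernel check of the chunk: for every listed `(i, R)`, row `i` of `rank3Table` exists, its row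
certificate checks, its TAMAGAWA PRODUCT lies in `rowVals` and equals the engines' product `rowValue`
when the row is exact, `c_v ∈ E.vals` at the place over each listed prime and `c_v = 1` at every
other place (global minimality of the row is the cell's theorem `Rank3Row.isGloballyMinimal_of_mem`).
[cite: SilvermanATAEC1994, IV.9.4] [cite: CremonaAlgorithms1997, Table 1] -/
theorem tamagawa_of_tamWalk {ps : List (ℕ × List TamC)} (h : tamWalk rank3Table 0 ps = true)
    {i : ℕ} {R : List TamC} (hm : (i, R) ∈ ps) :
    ∃ hi : i < rank3Table.length,
      TamLocal.rowCheck (R.map TamC.toLocal) (rank3Table[i]'hi).intModel = true ∧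
      (rank3Table[i]'hi).curve.tamagawaProduct ∈ TamLocal.rowVals (R.map TamC.toLocal) ∧
      (TamLocal.rowExact (R.map TamC.toLocal) = true →
        (rank3Table[i]'hi).curve.tamagawaProduct = TamLocal.rowValue (R.map TamC.toLocal)) ∧
      (∀ E ∈ R.map TamC.toLocal, ∀ v : HeightOneSpectrum (𝓞 ℚ), natGenerator v = E.p →
        tam (rank3Table[i]'hi).intModel v ∈ E.vals) ∧
      (∀ v : HeightOneSpectrum (𝓞 ℚ), natGenerator v ∉ (R.map TamC.toLocal).map (·.p) →
        tam (rank3Table[i]'hi).intModel v = 1) := by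
  obtain ⟨-, r, hrc, hc⟩ := entry_of_tamWalk _ 0 ps h i R hm
  rw [Nat.sub_zero] at hrc
  obtain ⟨hi, rfl⟩ := List.getElem?_eq_some_iff.mp hrc
  have hGM : ((rank3Table[i]'hi).intModel.baseChange ℚ).IsGloballyMinimal := by
    rw [← Rank3Row.curve_eq_baseChange]
    exact Rank3Row.isGloballyMinimal_of_mem (List.getElem_mem hi)
  refine ⟨hi, hc, ?_, fun hx ↦ ?_, fun E hE v hv ↦ TamLocal.tam_mem_vals_of_mem hc hGM hE v hv,
    fun v hv ↦ TamLocal.tam_eq_one_of_not_mem hc v hv⟩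
  · rw [Rank3Row.curve_eq_baseChange]; exact TamLocal.tamagawaProduct_mem hc hGM
  · rw [Rank3Row.curve_eq_baseChange]; exact TamLocal.tamagawaProduct_eq hc hGM hx

/-- Row form of the product statement. [cite: SilvermanATAEC1994, IV.9.4] -/
theorem tamagawaProduct_mem_of_listed {ps : List (ℕ × List TamC)} (h : tamWalk rank3Table 0 ps = true)
    {r : Rank3Row} {i : ℕ} {R : List TamC} (hm : (i, R) ∈ ps) (hr : rank3Table[i]? = some r) :
    r.curve.tamagawaProduct ∈ TamLocal.rowVals (R.map TamC.toLocal) ∧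
      (TamLocal.rowExact (R.map TamC.toLocal) = true →
        r.curve.tamagawaProduct = TamLocal.rowValue (R.map TamC.toLocal)) := by
  obtain ⟨hi, -, hmem, hex, -, -⟩ := tamagawa_of_tamWalk h hm
  obtain ⟨hi', rfl⟩ := List.getElem?_eq_some_iff.mp hr
  exact ⟨hmem, hex⟩

/-! ### Self-test (kernel): rows `0` (`5077a1`) and `1` of the census -/

/-- Rows `0` = `5077a1 = [0,0,1,-7,6]` (`I₁` non-split at `5077`, Euler witness, `c = 1`) and
`1` = `11197a1 = [1,-1,1,-6,0]` (`I₁` at `11197`, `c = 1`) pass the walk (engine 1 `tam.py`,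
engine 2 PARI `elllocalred`). [cite: CremonaAlgorithms1997, Table 1] -/
theorem tamWalk_rows_0_1 :
    tamWalk rank3Table 0 [(0, [.m 5077 71 3 0 1 1]), (1, [.m 11197 105 3 0 1 1])] = true := by
  decide +kernel

/-- Hence `∏_v c_v (5077a1) = 1`, kernel-certified. [cite: CremonaAlgorithms1997, Table 1] -/
theorem tamagawaProduct_5077a1 :
    (rank3Table[0]'(by rw [rank3Table_length]; omega)).curve.tamagawaProduct = 1 :=
  ((tamagawa_of_tamWalk tamWalk_rows_0_1 (i := 0) (R := [.m 5077 71 3 0 1 1]) (by simp)).2.2.2.1)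
    (by decide)

end Summit.BirchSwinnertonDyer.BirchSwinnertonDyer.Rank2Observatory.Tam
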